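import Literature.Computability.MetaComplexity.KDNFResolution
import HarnessLib

/-!
# The `Res(k)` rung for expanding linear systems, IVa: paths below a partial assignment

Support file for `stmt-PneNP-11443`. Bookkeeping for the Segerlind–Buss–Impagliazzo conversion
(file IV): a PATH below a partial assignment `ρ` is a finite consistent set `p` of literals on
variables left unassigned by `ρ` (`IsPath ρ p`); `ext ρ p` is the partial assignment `ρ ∪ p`,
`negPath p` the clause `¬p`. We record how `ext` interacts with insertion of a literal
(`ext_insert` = updating the assignment) and with `ρ`.

[Segerlind–Buss–Impagliazzo 2004, §5; Ben-Sasson–Wigderson 2001, §3 (restrictions)]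
-/

namespace Summit.PneNP.PneNP.Theorems.ResKRestriction

open Finset Literature.Computability.Complexity Literature.Computability.MetaComplexity

/-! ### Paths: finite consistent extensions of a partial assignment -/

/-- The value a set of literals `p` gives to the variable `x` (if any). [folklore] -/
def pval (p : Finset (Literal ℕ)) (x : ℕ) : Option Bool :=
  if (x, true) ∈ p then some true else if (x, false) ∈ p then some false else none

/-- The partial assignment `ρ` extended by the literals of `p` (on variables `ρ` leaves free).
[Segerlind–Buss–Impagliazzo 2004, §5] [folklore] -/
def ext (ρ : ℕ → Option Bool) (p : Finset (Literal ℕ)) : ℕ → Option Bool :=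
  fun x => match ρ x with
    | some b => some b
    | none => pval p x

/-- `IsPath ρ p`: the literals of `p` are on variables unassigned by `ρ`, and `p` is consistent
(no complementary pair). [folklore] -/
structure IsPath (ρ : ℕ → Option Bool) (p : Finset (Literal ℕ)) : Prop where
  /-- path variables are free in `ρ` -/
  free : ∀ l ∈ p, ρ l.1 = none
  /-- no complementary literals -/
  cons : ∀ l ∈ p, l.negate ∉ p

/-- `ext` agrees with `ρ` where `ρ` is defined. [folklore] -/
theorem ext_of_some {ρ : ℕ → Option Bool} (p : Finset (Literal ℕ)) {x : ℕ} {b : Bool}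
    (hx : ρ x = some b) : ext ρ p x = some b := by
  simp [ext, hx]

/-- `ext` reads the path where `ρ` is undefined. [folklore] -/
theorem ext_of_none {ρ : ℕ → Option Bool} (p : Finset (Literal ℕ)) {x : ℕ} (hx : ρ x = none) :
    ext ρ p x = pval p x := by
  simp [ext, hx]

/-- The value of a consistent path at a literal it contains. [folklore] -/
theorem pval_eq_of_mem {p : Finset (Literal ℕ)} (hcons : ∀ l ∈ p, l.negate ∉ p) {l : Literal ℕ}
    (hl : l ∈ p) : pval p l.1 = some l.2 := by
  rcases l with ⟨x, b⟩
  cases b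
  · have : (x, true) ∉ p := hcons _ hl
    simp [pval, this, hl]
  · simp [pval, hl]

/-- Reading off membership from the value of a path. [folklore] -/
theorem mem_of_pval_eq {p : Finset (Literal ℕ)} {x : ℕ} {b : Bool} (h : pval p x = some b) :
    (x, b) ∈ p := by
  unfold pval at h
  split_ifs at h with h1 h2
  · cases h; exact h1
  · cases h; exact h2

/-- `pval p x = none` iff no literal of `p` is on `x`. [folklore] -/
theorem pval_eq_none_iff {p : Finset (Literal ℕ)} {x : ℕ} : pval p x = none ↔ ∀ b, (x, b) ∉ p := by
  unfold pval
  split_ifs with h1 h2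
  · simp only [false_iff, not_forall, not_not]; exact ⟨true, h1⟩
  · simp only [false_iff, not_forall, not_not]; exact ⟨false, h2⟩
  · simp only [true_iff]; intro b; cases b <;> assumption

/-- On a path, `ext ρ p` takes the path's value at path literals. [folklore] -/
theorem IsPath.ext_eq {ρ : ℕ → Option Bool} {p : Finset (Literal ℕ)} (hp : IsPath ρ p)
    {l : Literal ℕ} (hl : l ∈ p) : ext ρ p l.1 = some l.2 := by
  rw [ext_of_none p (hp.free l hl), pval_eq_of_mem hp.cons hl]

/-- The empty path. [folklore] -/
theorem isPath_empty (ρ : ℕ → Option Bool) : IsPath ρ ∅ := ⟨by simp, by simp⟩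

/-- `ext ρ ∅ = ρ`. [folklore] -/
theorem ext_empty (ρ : ℕ → Option Bool) : ext ρ ∅ = ρ := by
  funext x
  cases hρ : ρ x with
  | some b => exact ext_of_some ∅ hρ
  | none => rw [ext_of_none ∅ hρ]; simp [pval]

/-- Extending a path by a literal on a variable free in `ext ρ p`. [folklore] -/
theorem IsPath.insert {ρ : ℕ → Option Bool} {p : Finset (Literal ℕ)} (hp : IsPath ρ p) {x : ℕ}
    (hx : ext ρ p x = none) (b : Bool) : IsPath ρ (insert (x, b) p) := by
  have hρx : ρ x = none := by
    cases hρ : ρ x with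
    | none => rfl
    | some b' => rw [ext_of_some p hρ] at hx; exact absurd hx (by simp)
  have hpx : ∀ b', (x, b') ∉ p := pval_eq_none_iff.1 (by rwa [ext_of_none p hρx] at hx)
  refine ⟨fun l hl => ?_, fun l hl hneg => ?_⟩
  · rcases Finset.mem_insert.1 hl with rfl | hl
    · exact hρx
    · exact hp.free l hl
  · rcases Finset.mem_insert.1 hl with rfl | hl
    · rcases Finset.mem_insert.1 hneg with h | h
      · simp [Literal.negate] at h
      · exact hpx _ h
    · rcases Finset.mem_insert.1 hneg with h | h
      · apply hpx l.2
        have : l = Literal.negate (x, b) := by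
          rw [← h]; simp [Literal.negate]
        rw [this] at hl ⊢; simpa [Literal.negate] using hl
      · exact hp.cons l hl h

/-- Extending the path by `(x, b)` is updating the assignment at `x`. [folklore] -/
theorem ext_insert {ρ : ℕ → Option Bool} {p : Finset (Literal ℕ)} (hp : IsPath ρ p) {x : ℕ}
    (hx : ext ρ p x = none) (b : Bool) :
    ext ρ (insert (x, b) p) = Function.update (ext ρ p) x (some b) := by
  have hq := hp.insert hx b
  funext y
  by_cases hyx : y = x
  · subst hyx
    rw [Function.update_self]
    exact hq.ext_eq (Finset.mem_insert_self _ _)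
  · rw [Function.update_of_ne hyx]
    cases hρ : ρ y with
    | some b' => rw [ext_of_some _ hρ, ext_of_some _ hρ]
    | none =>
      rw [ext_of_none _ hρ, ext_of_none _ hρ]
      simp [pval, hyx]

/-- The clause `¬p` negating a path. [folklore] -/
def negPath (p : Finset (Literal ℕ)) : Finset (Literal ℕ) :=
  p.image Literal.negate

/-- `negate` is an involution. [folklore] -/
theorem negate_negate (l : Literal ℕ) : l.negate.negate = l := by
  simp [Literal.negate]

/-- `|¬p| = |p|`. [folklore] -/
theorem card_negPath (p : Finset (Literal ℕ)) : (negPath p).card = p.card :=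
  Finset.card_image_of_injective _ fun l l' h => by
    have := congrArg Literal.negate h; rwa [negate_negate, negate_negate] at this

/-- Membership in `¬p`. [folklore] -/
theorem mem_negPath {p : Finset (Literal ℕ)} {l : Literal ℕ} : l ∈ negPath p ↔ l.negate ∈ p := by
  constructor
  · intro h
    obtain ⟨l', hl', rfl⟩ := Finset.mem_image.1 h
    rwa [negate_negate]
  · intro h
    exact Finset.mem_image.2 ⟨l.negate, h, negate_negate l⟩

/-- `¬` is monotone on paths. [folklore] -/
theorem negPath_mono {p q : Finset (Literal ℕ)} (h : p ⊆ q) : negPath p ⊆ negPath q :=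
  Finset.image_subset_image h

/-- `¬(p ∪ {(x,b)}) = ¬p ∪ {(x,¬b)}`. [folklore] -/
theorem negPath_insert (p : Finset (Literal ℕ)) (x : ℕ) (b : Bool) :
    negPath (insert (x, b) p) = insert (x, !b) (negPath p) := by
  simp [negPath, Finset.image_insert, Literal.negate]

end Summit.PneNP.PneNP.Theorems.ResKRestriction
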